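import Summits.QuantumFields.YangMills.Theorems.BlockPlaquetteOneStepLinearisationCoupled
import HarnessLib

/-!
# `BlockPlaquetteOneStepLinearisation` — ONE AVERAGING STEP OF [Balaban1987RG1] (0.4) WITH `exp[mean log]` ON `SU(N)`: THE COARSE PLAQUETTE OF THE
# AVERAGED LINKS IS THE OFFSET-MEAN OF THE TRANSPORTED TRANSLATED `L×L` LOOPS, TO SECOND ORDER, WITH THE MEAN KEPT SYMBOLIC (file 2 of 3 of brick (M1))

Cell `ym3-torus` (YM ladder rung R3 = continuum SU(2) Yang–Mills on T³ — a RUNG, NOT the Clay problem: not d = 4, not infinite volume, not a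
mass gap), crux of record `UnitScaleTilt.HistoryTailL` (stmt-QuantumFields-19936), width seat `ym-ust-19936-w2` (gen 14).  Brick **(M1)** of the
crux idea «gross-sd-transfer» (LINE 28 candidate, `Cruxes/HistoryTailL/Ideas/gross-sd-transfer.md`, annex 1 §2 (iv) ∕ §3 «S_lin»; this seat's LOCATE
`LOCATE-LINE28-SLIN-w2g14.md` = 19936 evidence #51; ideator word «w2: GO (M1)» 2026-08-29T16:31:51Z): the FIRST of the four missing pieces of the
linearisation `dist₁(Ū^j(∂a)) = |linear flux functional| + O(·)` on the crux's own types — the AVERAGING step (the Stokes step (b′) is px10 g7's,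
the j-fold induction (M3) and the `log` chart (M4) are later bricks).

WHAT IS PRINTED.  T. Bałaban, *Averaging operations for lattice gauge theories*, Commun. Math. Phys. **98** (1985) 17–51 [Balaban1985Averaging],
p. 25–26, inside the proof of Proposition 1 (51): *«|V̄₀(∂p′) − 1 − i Σ_{c⊂∂p′} Σ_{x∈B(c₋)} L^{−d} A(Γ_{c,x})| < O(1)(L²α₀)² (47)  Denoting by
(p′)_x a plaquette obtained by translation of the plaquette p′ to the point x, we have the identity Σ_{c⊂∂p′} Σ_{x∈B(c₋)} L^{−d} A(Γ_{c,x}) =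
Σ_{x∈B(y₀)} L^{−d} A(∂(p′)_x) (48)»* — the coarse plaquette of the averaged field is, to FIRST order, the block mean of the TRANSLATED COARSE
SQUARES `∂(p′)_x`.  T. Bałaban, *Renormalization group approach to lattice gauge field theories. I*, Commun. Math. Phys. **109** (1987) 249–301
[Balaban1987RG1], (0.3)–(0.4) pp. 252–253 (the symmetric block averaging with all staircase orderings) and p. 253 *«The considerations and
results of this, and previous papers, do not depend on any particular averaging operation used»*.

WHAT THIS FILE PROVES (kernel; 0 `def`, 0 `sorry`; file 2 of 3, one namespace with file 1 `…Coupled`).  With ✓`plaqHol_avgFun_eq_five`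
(`Ū(∂p′) = κ₁·(S₁κ₂S₁⁻¹)·Q·(S₄κ₃⁻¹S₄⁻¹)·κ₄⁻¹`), ✓`norm_corr_sub_mean_le` (each `exp[mean log]` correction factor is the mean of its loop variables to
second order), the coupling lemmas ✓`mean_couple₁₂∕₂₃∕₅₄∕₁₅` and file 1's ★★`coupled_first_order_sub_transportedSquare_le_of_atoms`:
* ★★★ `norm_plaqHol_avgFun_sub_one_sub_offsetMean_le_of_atoms` and its global-letter instance ★★★ `norm_plaqHol_avgFun_sub_one_sub_offsetMean_le`:
  if every plaquette variable of `U : GaugeField P j SU(N)` is within `a` of `1` and `s = (((d+4)L)²/4)·a ≤ δ_N/2`, then for every coarse plaquette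
  `p′ = ⟨y; μ < ν⟩`
    `‖(Ū(∂p′) − 1) − |J|⁻¹ Σ_J (T_{r,σ}·U(∂(p′)_{x(r,σ)})·T_{r,σ}⁻¹ − 1)‖ ≤ 143·s²`,   `J = (Fin d → Fin L) × (Perm (Fin d))⁴`,
  i.e. the coarse plaquette deviation IS the offset-mean of the transported translated-square deviations up to an explicit SECOND-ORDER remainder
  (the first-order content of (47)–(48) for (0.4), with NO gauge fixing and no range hypothesis; the tree's ✓`dist1_plaqHol_avgFun_le_of_atoms`
  is the same proof followed by `‖mean‖ ≤ L²a`).  File 3 (`…Readings`) collapses the mean to `(r, σ)`, bounds it, and records the `dist₁` readings.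
Constants crude and explicit; `n` any nonempty `Fintype` (`SU(N)`), any `Params`, any level `j`.

HONEST FRAMING.  Deterministic lattice bookkeeping on the tree's own objects; a helper toward an UNREGISTERED idea's stub (S_lin of LINE 28) and
line-independent infrastructure (also the first-order half of LINE 15's `stub_levelOneLipschitz` Schur bound); `--supports stmt-QuantumFields-19936`.
It proves no stub, crux, rung or summit statement; nothing of Bałaban's beyond the displayed algebra is asserted; S_lin ∕ S_dom ∕
«ShallowFluxSecondMomentL» ∕ (Q) ∕ K1 ∕ `MeanDeviationL` ∕ `HistoryTailL` are NOT proved; the Yang–Mills mass gap is NOT proved.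

References: [Balaban1985Averaging] T. Bałaban, CMP 98 (1985) 17–51, (47)–(48) and Prop. 1 (51) pp. 25–26; [Balaban1987RG1] T. Bałaban, CMP 109
(1987) 249–301, (0.3)–(0.4) pp. 252–253.
-/

noncomputable section

open scoped BigOperators

namespace Summit.QuantumFields.YangMills.Theorems.BlockPlaquetteOneStepLinearisation

open Literature.MathematicalPhysics.QuantumFieldTheory.Balaban1983to89
open Literature.MathematicalPhysics.QuantumFieldTheory.Balaban1983to89.BlockAveragingEMLProp2

/-! ## §1 Private letters (as in the tree module `BlockAveragingEMLProp2` and file 1, which keep them private) -/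

section Algebra

variable {𝔸 : Type*} [NormedRing 𝔸]

/-- `‖∏ xᵢ − 1‖ ≤ (1+b)^n − 1` for a list of `n` elements within `b` of `1`. [folklore] -/
private theorem norm_prod_sub_one_le (b : ℝ) (hb : 0 ≤ b) :
    ∀ l : List 𝔸, (∀ x ∈ l, ‖x - 1‖ ≤ b) → ‖l.prod - 1‖ ≤ (1 + b) ^ l.length - 1
  | [], _ => by simp
  | x :: l, h => by
    have hx : ‖x - 1‖ ≤ b := h x (by simp)
    have ih := norm_prod_sub_one_le b hb l fun y hy => h y (by simp [hy])
    have hP : 0 ≤ (1 + b) ^ l.length - 1 := by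
      have : (1 : ℝ) ≤ (1 + b) ^ l.length := one_le_pow₀ (by linarith)
      linarith
    rw [List.prod_cons, List.length_cons]
    have e : x * l.prod - 1 = (x - 1) * (l.prod - 1) + (x - 1) + (l.prod - 1) := by noncomm_ring
    rw [e]
    calc ‖(x - 1) * (l.prod - 1) + (x - 1) + (l.prod - 1)‖
        ≤ ‖x - 1‖ * ‖l.prod - 1‖ + ‖x - 1‖ + ‖l.prod - 1‖ :=
          (norm_add_le _ _).trans (add_le_add ((norm_add_le _ _).trans (add_le_add (norm_mul_le _ _) le_rfl)) le_rfl)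
      _ ≤ b * ((1 + b) ^ l.length - 1) + b + ((1 + b) ^ l.length - 1) := by gcongr
      _ = (1 + b) ^ (l.length + 1) - 1 := by ring

/-- Products of near-`1` elements to second order: `‖∏ xᵢ − 1 − Σ (xᵢ − 1)‖ ≤ (1+b)^n − 1 − n·b`. [folklore] -/
private theorem norm_prod_sub_one_sub_sum_le (b : ℝ) (hb : 0 ≤ b) :
    ∀ l : List 𝔸, (∀ x ∈ l, ‖x - 1‖ ≤ b) →
      ‖l.prod - 1 - (l.map (· - 1)).sum‖ ≤ (1 + b) ^ l.length - 1 - l.length * b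
  | [], _ => by simp
  | x :: l, h => by
    have hx : ‖x - 1‖ ≤ b := h x (by simp)
    have h' : ∀ y ∈ l, ‖y - 1‖ ≤ b := fun y hy => h y (by simp [hy])
    have ih := norm_prod_sub_one_sub_sum_le b hb l h'
    have ih₁ := norm_prod_sub_one_le b hb l h'
    rw [List.prod_cons, List.length_cons, List.map_cons, List.sum_cons]
    have e : x * l.prod - 1 - ((x - 1) + (l.map (· - 1)).sum) =
        (x - 1) * (l.prod - 1) + (l.prod - 1 - (l.map (· - 1)).sum) := by noncomm_ring
    rw [e]
    calc ‖(x - 1) * (l.prod - 1) + (l.prod - 1 - (l.map (· - 1)).sum)‖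
        ≤ ‖x - 1‖ * ‖l.prod - 1‖ + ‖l.prod - 1 - (l.map (· - 1)).sum‖ :=
          (norm_add_le _ _).trans (add_le_add (norm_mul_le _ _) le_rfl)
      _ ≤ b * ((1 + b) ^ l.length - 1) + ((1 + b) ^ l.length - 1 - l.length * b) := by gcongr
      _ = (1 + b) ^ (l.length + 1) - 1 - ((l.length + 1 : ℕ) : ℝ) * b := by push_cast; ring

/-- Five factors: `‖x₁x₂x₃x₄x₅ − 1 − Σ(xᵢ − 1)‖ ≤ 26b²` when every `‖xᵢ − 1‖ ≤ b ≤ 1`. [folklore] -/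
private theorem norm_prod_five_sub_le {x₁ x₂ x₃ x₄ x₅ : 𝔸} {b : ℝ} (hb : 0 ≤ b) (hb1 : b ≤ 1)
    (h₁ : ‖x₁ - 1‖ ≤ b) (h₂ : ‖x₂ - 1‖ ≤ b) (h₃ : ‖x₃ - 1‖ ≤ b) (h₄ : ‖x₄ - 1‖ ≤ b) (h₅ : ‖x₅ - 1‖ ≤ b) :
    ‖x₁ * x₂ * x₃ * x₄ * x₅ - 1 - ((x₁ - 1) + (x₂ - 1) + (x₃ - 1) + (x₄ - 1) + (x₅ - 1))‖ ≤ 26 * b ^ 2 := by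
  have h := norm_prod_sub_one_sub_sum_le b hb [x₁, x₂, x₃, x₄, x₅] (by simp [h₁, h₂, h₃, h₄, h₅])
  simp only [List.prod_cons, List.prod_nil, mul_one, List.map_cons, List.map_nil, List.sum_cons, List.sum_nil,
    add_zero, List.length_cons, List.length_nil] at h
  have e : (1 + b) ^ (0 + 1 + 1 + 1 + 1 + 1) - 1 - ((0 + 1 + 1 + 1 + 1 + 1 : ℕ) : ℝ) * b
      = b ^ 2 * (10 + 10 * b + 5 * b ^ 2 + b ^ 3) := by push_cast; ring
  rw [e] at h
  have hb' : b ^ 2 * (10 + 10 * b + 5 * b ^ 2 + b ^ 3) ≤ 26 * b ^ 2 := by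
    have h26 : 10 + 10 * b + 5 * b ^ 2 + b ^ 3 ≤ 26 := by nlinarith [sq_nonneg b, mul_nonneg hb (sq_nonneg b)]
    nlinarith [sq_nonneg b]
  simpa [mul_assoc, add_assoc] using h.trans hb'

end Algebra

section MeanLetters

variable {𝔸 : Type*} [NormedRing 𝔸] [NormedAlgebra ℂ 𝔸] {ι : Type*} [Fintype ι]

/-- The mean of a family bounded by `B` in norm has norm `≤ B`. [folklore] -/
private theorem norm_mean_le [Nonempty ι] {m : ι → 𝔸} {B : ℝ} (h : ∀ i, ‖m i‖ ≤ B) :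
    ‖((Fintype.card ι : ℂ))⁻¹ • ∑ i, m i‖ ≤ B := by
  have hc : (0 : ℝ) < Fintype.card ι := Nat.cast_pos.mpr Fintype.card_pos
  have hsum : ∑ i, ‖m i‖ ≤ ∑ _i : ι, B := Finset.sum_le_sum fun i _ => h i
  rw [Finset.sum_const, Finset.card_univ, nsmul_eq_mul] at hsum
  rw [norm_smul, norm_inv, Complex.norm_natCast, inv_mul_le_iff₀ hc]
  exact (norm_sum_le _ _).trans hsum

/-- The mean of a constant family is the constant. [folklore] -/
private theorem mean_const [Nonempty ι] (X : 𝔸) : ((Fintype.card ι : ℂ))⁻¹ • ∑ _i : ι, X = X := by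
  have hc : (Fintype.card ι : ℂ) ≠ 0 := Nat.cast_ne_zero.mpr Fintype.card_ne_zero
  rw [Finset.sum_const, Finset.card_univ, ← Nat.cast_smul_eq_nsmul ℂ, smul_smul, inv_mul_cancel₀ hc, one_smul]

end MeanLetters

/-! ## §3 The coarse plaquette of the averaged links = the offset-mean of the transported translated squares, to second order -/

section Main

open T4Continuum BlockAveraging AveragingRT ExpMeanLog LatticeWordStokes B10Eq47AxialChi NormedSpace
open scoped Matrix.Norms.L2Operator

variable {n : Type*} [Fintype n] [DecidableEq n] [Nonempty n] {P : Params} {j : ℕ}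
omit [Nonempty n] in
/-- Elements of `SU(N)` are unitary matrices. [folklore] -/
private theorem coe_mem_unitaryGroup (g : Matrix.specialUnitaryGroup n ℂ) : (g : Matrix n n ℂ) ∈ Matrix.unitaryGroup n ℂ :=
  (Matrix.mem_specialUnitaryGroup_iff.1 g.2).1

omit [Nonempty n] in
/-- `g · g* = 1` for `g ∈ SU(N)`. [folklore] -/
private theorem coe_mul_star_self (g : Matrix.specialUnitaryGroup n ℂ) : (g : Matrix n n ℂ) * star (g : Matrix n n ℂ) = 1 :=
  Unitary.mul_star_self_of_mem (coe_mem_unitaryGroup g)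


omit [Nonempty n] in
/-- The inverse in `SU(N)` is the conjugate transpose (coercion lemma). [folklore] -/
private theorem coe_inv_eq_star (g : Matrix.specialUnitaryGroup n ℂ) :
    ((g⁻¹ : Matrix.specialUnitaryGroup n ℂ) : Matrix n n ℂ) = star (g : Matrix n n ℂ) := rfl

omit [Nonempty n] in
/-- `g*` is unitary for `g ∈ SU(N)`. [folklore] -/
private theorem star_coe_mem_unitaryGroup (g : Matrix.specialUnitaryGroup n ℂ) : star (g : Matrix n n ℂ) ∈ Matrix.unitaryGroup n ℂ :=
  coe_mem_unitaryGroup g⁻¹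


-- hb: measured FAIL at maxHeartbeats 100000 (whnf in the five-factor assembly), PASS at the default 200000; decl-local budget per cell README.
set_option maxHeartbeats 400000 in
/-- **THE COARSE PLAQUETTE OF THE (0.4)+`exp[mean log]` AVERAGED FIELD TO FIRST ORDER, WITH THE OFFSET-MEAN KEPT (atomised form).**  For
`p′ = ⟨y; μ < ν⟩` on `T^{(j+1)}` and `U : GaugeField P j SU(N)`: if the loop variables at the four bonds of `∂p′` are within `(((d+2)L)²/4)·a` of `1`,
every transport loop `Z` is within `s = (((d+4)L)²/4)·a`, the straight coarse square and every translated square `(p′)_x` are within `L²a`, and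
`s ≤ δ_N/2`, then
  `‖(Ū(∂p′) − 1) − |J|⁻¹ Σ_{J=(r,σ,τ,ρ,ω)} (T_{r,σ}·U(∂(p′)_{x(r,σ)})·T_{r,σ}⁻¹ − 1)‖ ≤ 143·s²`
— print's (47)–(48) «the coarse plaquette of the averaged configuration is, to first order, the block mean of the translated coarse squares» for
the averaging OF RECORD, with an explicit second-order remainder and NO gauge fixing (`T_{r,σ} = U(Γ^σ_{y→x})` the staircase transporter, so every
summand is gauge-COVARIANT at `emb y`).  Mechanism = the tree's proof of ✓`dist1_plaqHol_avgFun_le_of_atoms`, stopped one step earlier.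
[cite: Balaban1985Averaging, (47)-(48) and Prop. 1 (51) pp.25-26; Balaban1987RG1, (0.3)-(0.4) pp.252-253] -/
theorem norm_plaqHol_avgFun_sub_one_sub_offsetMean_le_of_atoms {a : ℝ} (ha : 0 ≤ a) {U : GaugeField P j (Matrix.specialUnitaryGroup n ℂ)}
    (hs : ((((P.d + 4) * P.L : ℕ) : ℝ) ^ 2 / 4) * a ≤ deltaSU n / 2) (y : Site P (j + 1)) {μ ν : Fin P.d} (hμν : μ < ν)
    (hW₁ : ∀ i, dist1 (loopHol U ⟨y, μ⟩ i) ≤ ((((P.d + 2) * P.L : ℕ) : ℝ) ^ 2 / 4) * a)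
    (hW₂ : ∀ i, dist1 (loopHol U ⟨y.shift μ, ν⟩ i) ≤ ((((P.d + 2) * P.L : ℕ) : ℝ) ^ 2 / 4) * a)
    (hW₃ : ∀ i, dist1 (loopHol U ⟨y.shift ν, μ⟩ i) ≤ ((((P.d + 2) * P.L : ℕ) : ℝ) ^ 2 / 4) * a)
    (hW₄ : ∀ i, dist1 (loopHol U ⟨y, ν⟩ i) ≤ ((((P.d + 2) * P.L : ℕ) : ℝ) ^ 2 / 4) * a)
    (hZ : ∀ (r : Fin P.d → Fin P.L) (σ ρ : Equiv.Perm (Fin P.d)),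
      dist1 (holAt U (walk (emb y) (stairWord σ (off r) ++ (List.replicate P.L (μ, true) ++ (List.replicate P.L (ν, true) ++
        (wordRev (stairWord ρ (off r)) ++ (List.replicate P.L (ν, false) ++ List.replicate P.L (μ, false)))))))) ≤
      ((((P.d + 4) * P.L : ℕ) : ℝ) ^ 2 / 4) * a)
    (hsq : dist1 (rect U (emb y) μ ν P.L P.L) ≤ (P.L : ℝ) ^ 2 * a)
    (hsqσ : ∀ (r : Fin P.d → Fin P.L) (σ : Equiv.Perm (Fin P.d)),
      dist1 (rect U (walkEnd (emb y) (stairWord σ (off r))) μ ν P.L P.L) ≤ (P.L : ℝ) ^ 2 * a) :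
    ‖(((GaugeField.plaqHol (avgFun (expMeanLogSU (n := n)) U) ⟨y, μ, ν, hμν⟩ : Matrix.specialUnitaryGroup n ℂ) : Matrix n n ℂ) - 1) -
        ((Fintype.card ((Fin P.d → Fin P.L) × Equiv.Perm (Fin P.d) × Equiv.Perm (Fin P.d) × Equiv.Perm (Fin P.d) ×
          Equiv.Perm (Fin P.d)) : ℂ))⁻¹ • ∑ J : (Fin P.d → Fin P.L) × Equiv.Perm (Fin P.d) × Equiv.Perm (Fin P.d) ×
          Equiv.Perm (Fin P.d) × Equiv.Perm (Fin P.d),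
          ((((holAt U (walk (emb y) (stairWord J.2.1 (off J.1))) * rect U (walkEnd (emb y) (stairWord J.2.1 (off J.1))) μ ν P.L P.L *
            (holAt U (walk (emb y) (stairWord J.2.1 (off J.1))))⁻¹ : Matrix.specialUnitaryGroup n ℂ)) : Matrix n n ℂ) - 1)‖ ≤
      143 * (((((P.d + 4) * P.L : ℕ) : ℝ) ^ 2 / 4) * a) ^ 2 := by
  -- adapted from lit `BlockAveragingEMLProp2.dist1_plaqHol_avgFun_le_of_atoms`
  -- constants
  set s : ℝ := ((((P.d + 4) * P.L : ℕ) : ℝ) ^ 2 / 4) * a with hs_def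
  set θ : ℝ := ((((P.d + 2) * P.L : ℕ) : ℝ) ^ 2 / 4) * a with hθ_def
  set u : ℝ := (P.L : ℝ) ^ 2 * a with hu_def
  have hδ3 : deltaSU n ≤ 1 / 3 := min_le_left _ _
  have hδ0 : 0 < deltaSU n := deltaSU_pos
  have hs0 : 0 ≤ s := by positivity
  have hθ0 : 0 ≤ θ := by positivity
  have hu0 : 0 ≤ u := by positivity
  have hs6 : s ≤ 1 / 6 := by linarith
  have hθs : θ ≤ s := by
    rw [hs_def, hθ_def]
    apply mul_le_mul_of_nonneg_right _ ha
    apply div_le_div_of_nonneg_right _ (by norm_num)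
    exact_mod_cast Nat.pow_le_pow_left (Nat.mul_le_mul_right P.L (by omega : P.d + 2 ≤ P.d + 4)) 2
  have hus : u ≤ s := by
    rw [hs_def, hu_def]
    have hd : (0 : ℝ) ≤ P.d := Nat.cast_nonneg _
    have : (P.L : ℝ) ^ 2 ≤ (((P.d + 4) * P.L : ℕ) : ℝ) ^ 2 / 4 := by
      push_cast
      nlinarith [sq_nonneg (P.L : ℝ), mul_nonneg hd (sq_nonneg (P.L : ℝ)), mul_nonneg (mul_nonneg hd hd) (sq_nonneg (P.L : ℝ))]
    exact mul_le_mul_of_nonneg_right this ha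
  have hθδ : θ < deltaSU n := by linarith
  have hθ6 : θ ≤ 1 / 6 := hθs.trans hs6
  have hθ4 : θ ≤ 1 / 4 := hθ6.trans (by norm_num)
  haveI : Nonempty (Fin P.d → Fin P.L) := ⟨fun _ => ⟨0, P.L_pos⟩⟩
  -- atoms
  set κ₁ := corr (expMeanLogSU (n := n)) U ⟨y, μ⟩
  set κ₂ := corr (expMeanLogSU (n := n)) U ⟨y.shift μ, ν⟩
  set κ₃ := corr (expMeanLogSU (n := n)) U ⟨y.shift ν, μ⟩
  set κ₄ := corr (expMeanLogSU (n := n)) U ⟨y, ν⟩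
  set S₁ := axialAvg U ⟨y, μ⟩
  set S₄ := axialAvg U ⟨y, ν⟩
  set Qp := GaugeField.plaqHol (axialAvg U) ⟨y, μ, ν, hμν⟩
  have h5 : GaugeField.plaqHol (avgFun (expMeanLogSU (n := n)) U) ⟨y, μ, ν, hμν⟩ =
      κ₁ * (S₁ * κ₂ * S₁⁻¹) * Qp * (S₄ * κ₃⁻¹ * S₄⁻¹) * κ₄⁻¹ := by
    rw [plaqHol_avgFun_eq_five, ← plaqHol_axialAvg_eq]
  -- freeze the offset-mean (its summands must NOT be rewritten by the coercion lemmas below)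
  set Mn : Matrix n n ℂ := ((Fintype.card ((Fin P.d → Fin P.L) × Equiv.Perm (Fin P.d) × Equiv.Perm (Fin P.d) × Equiv.Perm (Fin P.d) ×
          Equiv.Perm (Fin P.d)) : ℂ))⁻¹ • ∑ J : (Fin P.d → Fin P.L) × Equiv.Perm (Fin P.d) × Equiv.Perm (Fin P.d) ×
          Equiv.Perm (Fin P.d) × Equiv.Perm (Fin P.d),
          ((((holAt U (walk (emb y) (stairWord J.2.1 (off J.1))) * rect U (walkEnd (emb y) (stairWord J.2.1 (off J.1))) μ ν P.L P.L *
            (holAt U (walk (emb y) (stairWord J.2.1 (off J.1))))⁻¹ : Matrix.specialUnitaryGroup n ℂ)) : Matrix n n ℂ) - 1) with hMn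
  rw [h5]
  simp only [Submonoid.coe_mul, coe_inv_eq_star]
  -- the five factors are within `2s` of `1`
  have hb0 : (0 : ℝ) ≤ 2 * s := by positivity
  have hb1 : 2 * s ≤ 1 := by linarith
  have hκ : ∀ c : PBond P (j + 1), (∀ i, dist1 (loopHol U c i) ≤ θ) →
      ‖((corr (expMeanLogSU (n := n)) U c : Matrix.specialUnitaryGroup n ℂ) : Matrix n n ℂ) - 1‖ ≤ 2 * s := fun c hWc => by
    rw [← FederbushMean.dist1_SU_eq]; exact (dist1_corr_le_two_mul U c hWc hθδ hθ6).trans (by linarith)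
  have h1 : ‖((κ₁ : Matrix.specialUnitaryGroup n ℂ) : Matrix n n ℂ) - 1‖ ≤ 2 * s := hκ _ hW₁
  have h2 : ‖(S₁ : Matrix n n ℂ) * ((κ₂ : Matrix.specialUnitaryGroup n ℂ) : Matrix n n ℂ) * star (S₁ : Matrix n n ℂ) - 1‖ ≤ 2 * s := by
    rw [norm_conj_sub_one_eq (coe_mem_unitaryGroup S₁) (star_coe_mem_unitaryGroup S₁) (coe_mul_star_self S₁)]; exact hκ _ hW₂
  have hq : ‖((Qp : Matrix.specialUnitaryGroup n ℂ) : Matrix n n ℂ) - 1‖ ≤ 2 * s := by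
    rw [← FederbushMean.dist1_SU_eq, show Qp = GaugeField.plaqHol (axialAvg U) ⟨y, μ, ν, hμν⟩ from rfl, plaqHol_axialAvg_eq_rect']
    exact hsq.trans (hus.trans (by linarith))
  have h3 : ‖(S₄ : Matrix n n ℂ) * star ((κ₃ : Matrix.specialUnitaryGroup n ℂ) : Matrix n n ℂ) * star (S₄ : Matrix n n ℂ) - 1‖
      ≤ 2 * s := by
    rw [norm_conj_sub_one_eq (coe_mem_unitaryGroup S₄) (star_coe_mem_unitaryGroup S₄) (coe_mul_star_self S₄), norm_star_sub_one]
    exact hκ _ hW₃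
  have h4 : ‖star ((κ₄ : Matrix.specialUnitaryGroup n ℂ) : Matrix n n ℂ) - 1‖ ≤ 2 * s := by
    rw [norm_star_sub_one]; exact hκ _ hW₄
  have hfive := norm_prod_five_sub_le hb0 hb1 h1 h2 hq h3 h4
  -- the coupled index and the four second-order linearisations
  have m1 : ((Fintype.card ((Fin P.d → Fin P.L) × Equiv.Perm (Fin P.d) × Equiv.Perm (Fin P.d) × Equiv.Perm (Fin P.d) ×
        Equiv.Perm (Fin P.d)) : ℂ))⁻¹ • ∑ J : (Fin P.d → Fin P.L) × Equiv.Perm (Fin P.d) × Equiv.Perm (Fin P.d) ×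
        Equiv.Perm (Fin P.d) × Equiv.Perm (Fin P.d),
        ((((loopHol U ⟨y, μ⟩ (J.1, J.2.1, J.2.2.1)) : Matrix.specialUnitaryGroup n ℂ) : Matrix n n ℂ) - 1) =
      ((Fintype.card (Idx P) : ℂ))⁻¹ • ∑ i : Idx P, ((((loopHol U ⟨y, μ⟩ i) : Matrix.specialUnitaryGroup n ℂ) : Matrix n n ℂ) - 1) :=
    mean_couple₁₂ (fun i : Idx P => ((((loopHol U ⟨y, μ⟩ i) : Matrix.specialUnitaryGroup n ℂ) : Matrix n n ℂ) - 1))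
  have m2 : ((Fintype.card ((Fin P.d → Fin P.L) × Equiv.Perm (Fin P.d) × Equiv.Perm (Fin P.d) × Equiv.Perm (Fin P.d) ×
        Equiv.Perm (Fin P.d)) : ℂ))⁻¹ • ∑ J : (Fin P.d → Fin P.L) × Equiv.Perm (Fin P.d) × Equiv.Perm (Fin P.d) ×
        Equiv.Perm (Fin P.d) × Equiv.Perm (Fin P.d),
        ((S₁ : Matrix n n ℂ) * ((((loopHol U ⟨y.shift μ, ν⟩ (J.1, J.2.2.1, J.2.2.2.1)) : Matrix.specialUnitaryGroup n ℂ) :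
          Matrix n n ℂ) - 1) * star (S₁ : Matrix n n ℂ)) =
      ((Fintype.card (Idx P) : ℂ))⁻¹ • ∑ i : Idx P, ((S₁ : Matrix n n ℂ) *
        ((((loopHol U ⟨y.shift μ, ν⟩ i) : Matrix.specialUnitaryGroup n ℂ) : Matrix n n ℂ) - 1) * star (S₁ : Matrix n n ℂ)) :=
    mean_couple₂₃ (fun i : Idx P => (S₁ : Matrix n n ℂ) *
      ((((loopHol U ⟨y.shift μ, ν⟩ i) : Matrix.specialUnitaryGroup n ℂ) : Matrix n n ℂ) - 1) * star (S₁ : Matrix n n ℂ))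
  have m3 : ((Fintype.card ((Fin P.d → Fin P.L) × Equiv.Perm (Fin P.d) × Equiv.Perm (Fin P.d) × Equiv.Perm (Fin P.d) ×
        Equiv.Perm (Fin P.d)) : ℂ))⁻¹ • ∑ J : (Fin P.d → Fin P.L) × Equiv.Perm (Fin P.d) × Equiv.Perm (Fin P.d) ×
        Equiv.Perm (Fin P.d) × Equiv.Perm (Fin P.d),
        ((S₄ : Matrix n n ℂ) * (star ((((loopHol U ⟨y.shift ν, μ⟩ (J.1, J.2.2.2.2, J.2.2.2.1)) : Matrix.specialUnitaryGroup n ℂ) :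
          Matrix n n ℂ)) - 1) * star (S₄ : Matrix n n ℂ)) =
      ((Fintype.card (Idx P) : ℂ))⁻¹ • ∑ i : Idx P, ((S₄ : Matrix n n ℂ) *
        (star ((((loopHol U ⟨y.shift ν, μ⟩ i) : Matrix.specialUnitaryGroup n ℂ) : Matrix n n ℂ)) - 1) * star (S₄ : Matrix n n ℂ)) :=
    mean_couple₅₄ (fun i : Idx P => (S₄ : Matrix n n ℂ) *
      (star ((((loopHol U ⟨y.shift ν, μ⟩ i) : Matrix.specialUnitaryGroup n ℂ) : Matrix n n ℂ)) - 1) * star (S₄ : Matrix n n ℂ))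
  have m4 : ((Fintype.card ((Fin P.d → Fin P.L) × Equiv.Perm (Fin P.d) × Equiv.Perm (Fin P.d) × Equiv.Perm (Fin P.d) ×
        Equiv.Perm (Fin P.d)) : ℂ))⁻¹ • ∑ J : (Fin P.d → Fin P.L) × Equiv.Perm (Fin P.d) × Equiv.Perm (Fin P.d) ×
        Equiv.Perm (Fin P.d) × Equiv.Perm (Fin P.d),
        (star ((((loopHol U ⟨y, ν⟩ (J.1, J.2.1, J.2.2.2.2)) : Matrix.specialUnitaryGroup n ℂ) : Matrix n n ℂ)) - 1) =
      ((Fintype.card (Idx P) : ℂ))⁻¹ • ∑ i : Idx P, (star ((((loopHol U ⟨y, ν⟩ i) : Matrix.specialUnitaryGroup n ℂ) :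
        Matrix n n ℂ)) - 1) :=
    mean_couple₁₅ (fun i : Idx P => star ((((loopHol U ⟨y, ν⟩ i) : Matrix.specialUnitaryGroup n ℂ) : Matrix n n ℂ)) - 1)
  have e1 := norm_corr_sub_mean_le U ⟨y, μ⟩ hW₁ hθδ hθ4
  rw [← m1] at e1
  have e2 := norm_conj_corr_sub_mean_le U ⟨y.shift μ, ν⟩ S₁ hW₂ hθδ hθ4
  rw [← m2] at e2
  have e3 := norm_conj_corr_star_sub_mean_le U ⟨y.shift ν, μ⟩ S₄ hW₃ hθδ hθ4
  rw [← m3] at e3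
  have e4 := norm_corr_star_sub_mean_le U ⟨y, ν⟩ hW₄ hθδ hθ4
  rw [← m4] at e4
  -- the per-index estimate with the translated square subtracted, averaged
  have hJ : ∀ J : (Fin P.d → Fin P.L) × Equiv.Perm (Fin P.d) × Equiv.Perm (Fin P.d) × Equiv.Perm (Fin P.d) × Equiv.Perm (Fin P.d),
      ‖((((loopHol U ⟨y, μ⟩ (J.1, J.2.1, J.2.2.1)) : Matrix.specialUnitaryGroup n ℂ) : Matrix n n ℂ) - 1) +
        ((S₁ : Matrix n n ℂ) * ((((loopHol U ⟨y.shift μ, ν⟩ (J.1, J.2.2.1, J.2.2.2.1)) : Matrix.specialUnitaryGroup n ℂ) :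
          Matrix n n ℂ) - 1) * star (S₁ : Matrix n n ℂ)) +
        ((S₄ : Matrix n n ℂ) * (star ((((loopHol U ⟨y.shift ν, μ⟩ (J.1, J.2.2.2.2, J.2.2.2.1)) : Matrix.specialUnitaryGroup n ℂ) :
          Matrix n n ℂ)) - 1) * star (S₄ : Matrix n n ℂ)) +
        (star ((((loopHol U ⟨y, ν⟩ (J.1, J.2.1, J.2.2.2.2)) : Matrix.specialUnitaryGroup n ℂ) : Matrix n n ℂ)) - 1) +
        (((Qp : Matrix.specialUnitaryGroup n ℂ) : Matrix n n ℂ) - 1) +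
        -((((holAt U (walk (emb y) (stairWord J.2.1 (off J.1))) * rect U (walkEnd (emb y) (stairWord J.2.1 (off J.1))) μ ν P.L P.L *
            (holAt U (walk (emb y) (stairWord J.2.1 (off J.1))))⁻¹ : Matrix.specialUnitaryGroup n ℂ)) : Matrix n n ℂ) - 1)‖
        ≤ 15 * s ^ 2 := fun J => by
    rw [← sub_eq_add_neg]
    exact coupled_first_order_sub_transportedSquare_le_of_atoms ha hs6 y hμν J.1 J.2.1 J.2.2.1 J.2.2.2.1 J.2.2.2.2 hW₁ hW₂ hW₃ hW₄
      (hZ _ _ _) hsq (hsqσ _ _)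
  have hmean' := norm_mean_le hJ
  simp only [Finset.sum_add_distrib, Finset.sum_neg_distrib, smul_add, smul_neg, mean_const] at hmean'
  have hmean : ‖((Fintype.card ((Fin P.d → Fin P.L) × Equiv.Perm (Fin P.d) × Equiv.Perm (Fin P.d) × Equiv.Perm (Fin P.d) ×
        Equiv.Perm (Fin P.d)) : ℂ))⁻¹ • ∑ J : (Fin P.d → Fin P.L) × Equiv.Perm (Fin P.d) × Equiv.Perm (Fin P.d) ×
        Equiv.Perm (Fin P.d) × Equiv.Perm (Fin P.d),
        ((((loopHol U ⟨y, μ⟩ (J.1, J.2.1, J.2.2.1)) : Matrix.specialUnitaryGroup n ℂ) : Matrix n n ℂ) - 1) +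
      ((Fintype.card ((Fin P.d → Fin P.L) × Equiv.Perm (Fin P.d) × Equiv.Perm (Fin P.d) × Equiv.Perm (Fin P.d) ×
        Equiv.Perm (Fin P.d)) : ℂ))⁻¹ • ∑ J : (Fin P.d → Fin P.L) × Equiv.Perm (Fin P.d) × Equiv.Perm (Fin P.d) ×
        Equiv.Perm (Fin P.d) × Equiv.Perm (Fin P.d),
        ((S₁ : Matrix n n ℂ) * ((((loopHol U ⟨y.shift μ, ν⟩ (J.1, J.2.2.1, J.2.2.2.1)) : Matrix.specialUnitaryGroup n ℂ) :
          Matrix n n ℂ) - 1) * star (S₁ : Matrix n n ℂ)) +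
      ((Fintype.card ((Fin P.d → Fin P.L) × Equiv.Perm (Fin P.d) × Equiv.Perm (Fin P.d) × Equiv.Perm (Fin P.d) ×
        Equiv.Perm (Fin P.d)) : ℂ))⁻¹ • ∑ J : (Fin P.d → Fin P.L) × Equiv.Perm (Fin P.d) × Equiv.Perm (Fin P.d) ×
        Equiv.Perm (Fin P.d) × Equiv.Perm (Fin P.d),
        ((S₄ : Matrix n n ℂ) * (star ((((loopHol U ⟨y.shift ν, μ⟩ (J.1, J.2.2.2.2, J.2.2.2.1)) : Matrix.specialUnitaryGroup n ℂ) :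
          Matrix n n ℂ)) - 1) * star (S₄ : Matrix n n ℂ)) +
      ((Fintype.card ((Fin P.d → Fin P.L) × Equiv.Perm (Fin P.d) × Equiv.Perm (Fin P.d) × Equiv.Perm (Fin P.d) ×
        Equiv.Perm (Fin P.d)) : ℂ))⁻¹ • ∑ J : (Fin P.d → Fin P.L) × Equiv.Perm (Fin P.d) × Equiv.Perm (Fin P.d) ×
        Equiv.Perm (Fin P.d) × Equiv.Perm (Fin P.d),
        (star ((((loopHol U ⟨y, ν⟩ (J.1, J.2.1, J.2.2.2.2)) : Matrix.specialUnitaryGroup n ℂ) : Matrix n n ℂ)) - 1) +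
      (((Qp : Matrix.specialUnitaryGroup n ℂ) : Matrix n n ℂ) - 1) + -Mn‖ ≤ 15 * s ^ 2 := by
    rw [hMn]
    exact hmean'
  -- assemble
  have etot : ∀ (x₁ x₂ q x₃ x₄ f₁ f₂ f₃ f₄ m : Matrix n n ℂ), x₁ * x₂ * q * x₃ * x₄ - 1 - m =
      (x₁ * x₂ * q * x₃ * x₄ - 1 - ((x₁ - 1) + (x₂ - 1) + (q - 1) + (x₃ - 1) + (x₄ - 1))) +
      (((x₁ - 1) - f₁) + ((x₂ - 1) - f₂) + ((x₃ - 1) - f₃) + ((x₄ - 1) - f₄)) +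
      (f₁ + f₂ + f₃ + f₄ + (q - 1) + -m) := fun _ _ _ _ _ _ _ _ _ _ => by abel
  rw [etot _ _ _ _ _
    (((Fintype.card ((Fin P.d → Fin P.L) × Equiv.Perm (Fin P.d) × Equiv.Perm (Fin P.d) × Equiv.Perm (Fin P.d) ×
        Equiv.Perm (Fin P.d)) : ℂ))⁻¹ • ∑ J : (Fin P.d → Fin P.L) × Equiv.Perm (Fin P.d) × Equiv.Perm (Fin P.d) ×
        Equiv.Perm (Fin P.d) × Equiv.Perm (Fin P.d),
        ((((loopHol U ⟨y, μ⟩ (J.1, J.2.1, J.2.2.1)) : Matrix.specialUnitaryGroup n ℂ) : Matrix n n ℂ) - 1))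
    (((Fintype.card ((Fin P.d → Fin P.L) × Equiv.Perm (Fin P.d) × Equiv.Perm (Fin P.d) × Equiv.Perm (Fin P.d) ×
        Equiv.Perm (Fin P.d)) : ℂ))⁻¹ • ∑ J : (Fin P.d → Fin P.L) × Equiv.Perm (Fin P.d) × Equiv.Perm (Fin P.d) ×
        Equiv.Perm (Fin P.d) × Equiv.Perm (Fin P.d),
        ((S₁ : Matrix n n ℂ) * ((((loopHol U ⟨y.shift μ, ν⟩ (J.1, J.2.2.1, J.2.2.2.1)) : Matrix.specialUnitaryGroup n ℂ) :
          Matrix n n ℂ) - 1) * star (S₁ : Matrix n n ℂ)))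
    (((Fintype.card ((Fin P.d → Fin P.L) × Equiv.Perm (Fin P.d) × Equiv.Perm (Fin P.d) × Equiv.Perm (Fin P.d) ×
        Equiv.Perm (Fin P.d)) : ℂ))⁻¹ • ∑ J : (Fin P.d → Fin P.L) × Equiv.Perm (Fin P.d) × Equiv.Perm (Fin P.d) ×
        Equiv.Perm (Fin P.d) × Equiv.Perm (Fin P.d),
        ((S₄ : Matrix n n ℂ) * (star ((((loopHol U ⟨y.shift ν, μ⟩ (J.1, J.2.2.2.2, J.2.2.2.1)) : Matrix.specialUnitaryGroup n ℂ) :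
          Matrix n n ℂ)) - 1) * star (S₄ : Matrix n n ℂ)))
    (((Fintype.card ((Fin P.d → Fin P.L) × Equiv.Perm (Fin P.d) × Equiv.Perm (Fin P.d) × Equiv.Perm (Fin P.d) ×
        Equiv.Perm (Fin P.d)) : ℂ))⁻¹ • ∑ J : (Fin P.d → Fin P.L) × Equiv.Perm (Fin P.d) × Equiv.Perm (Fin P.d) ×
        Equiv.Perm (Fin P.d) × Equiv.Perm (Fin P.d),
        (star ((((loopHol U ⟨y, ν⟩ (J.1, J.2.1, J.2.2.2.2)) : Matrix.specialUnitaryGroup n ℂ) : Matrix n n ℂ)) - 1))]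
  refine (norm_add_le _ _).trans ((add_le_add ((norm_add_le _ _).trans (add_le_add hfive
    ((norm_add_le _ _).trans (add_le_add ((norm_add_le _ _).trans (add_le_add ((norm_add_le _ _).trans (add_le_add e1 e2)) e3)) e4))))
    hmean).trans ?_)
  nlinarith [mul_le_mul hθs hθs hθ0 hs0]

/-- **THE COARSE PLAQUETTE OF THE (0.4)+`exp[mean log]` AVERAGED FIELD TO FIRST ORDER, WITH THE OFFSET-MEAN KEPT (global letters).**  If every
plaquette variable of `U : GaugeField P j SU(N)` is within `a` of `1` and `s = (((d+4)L)²/4)·a ≤ δ_N/2`, then for every coarse plaquette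
`p′ = ⟨y; μ < ν⟩`:  `‖(Ū(∂p′) − 1) − |J|⁻¹ Σ_{J=(r,σ,τ,ρ,ω)} (T_{r,σ}·U(∂(p′)_{x(r,σ)})·T_{r,σ}⁻¹ − 1)‖ ≤ 143·s²` — the first-order content of
print's (47)–(48) for the averaging of record: the coarse plaquette deviation is the block∕ordering mean of the transported deviations of the
TRANSLATED COARSE SQUARES, up to an explicit second-order remainder. [cite: Balaban1985Averaging, (47)-(48) and Prop. 1 (51) pp.25-26; Balaban1987RG1, (0.3)-(0.4) pp.252-253] -/
theorem norm_plaqHol_avgFun_sub_one_sub_offsetMean_le {a : ℝ} (ha : 0 ≤ a) {U : GaugeField P j (Matrix.specialUnitaryGroup n ℂ)}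
    (hU : ∀ q : Plaq P j, dist1 (GaugeField.plaqHol U q) ≤ a)
    (hs : ((((P.d + 4) * P.L : ℕ) : ℝ) ^ 2 / 4) * a ≤ deltaSU n / 2) (y : Site P (j + 1)) {μ ν : Fin P.d} (hμν : μ < ν) :
    ‖(((GaugeField.plaqHol (avgFun (expMeanLogSU (n := n)) U) ⟨y, μ, ν, hμν⟩ : Matrix.specialUnitaryGroup n ℂ) : Matrix n n ℂ) - 1) -
        ((Fintype.card ((Fin P.d → Fin P.L) × Equiv.Perm (Fin P.d) × Equiv.Perm (Fin P.d) × Equiv.Perm (Fin P.d) ×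
          Equiv.Perm (Fin P.d)) : ℂ))⁻¹ • ∑ J : (Fin P.d → Fin P.L) × Equiv.Perm (Fin P.d) × Equiv.Perm (Fin P.d) ×
          Equiv.Perm (Fin P.d) × Equiv.Perm (Fin P.d),
          ((((holAt U (walk (emb y) (stairWord J.2.1 (off J.1))) * rect U (walkEnd (emb y) (stairWord J.2.1 (off J.1))) μ ν P.L P.L *
            (holAt U (walk (emb y) (stairWord J.2.1 (off J.1))))⁻¹ : Matrix.specialUnitaryGroup n ℂ)) : Matrix n n ℂ) - 1)‖ ≤
      143 * (((((P.d + 4) * P.L : ℕ) : ℝ) ^ 2 / 4) * a) ^ 2 :=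
  norm_plaqHol_avgFun_sub_one_sub_offsetMean_le_of_atoms ha hs y hμν (fun i => dist1_loopHol_le' ha hU _ i)
    (fun i => dist1_loopHol_le' ha hU _ i) (fun i => dist1_loopHol_le' ha hU _ i) (fun i => dist1_loopHol_le' ha hU _ i)
    (fun r σ ρ => dist1_zWord_le ha hU y μ ν σ ρ r) (dist1_rect_LL_le U hU (emb y) hμν) (fun _ _ => dist1_rect_LL_le U hU _ hμν)

end Main

end Summit.QuantumFields.YangMills.Theorems.BlockPlaquetteOneStepLinearisation

end
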